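/-
Copyright (c) 2026 the pub-hodgecm-mathlib formalisation cell (harness21).  Track B «K2-LIT» prover seat hodgecm-mathlib-K2E3-p15 (g2), 2026-09-04: road J of ‹S›,
letter J3 «RANK-ONE MASS», brick R3b-1 — the ANISOTROPIC UNITARY PLANE `U(⟨1, −ξ⟩)`, `ord ξ` odd: every element is integral, with entries and norms pinned
by valuation parity (generic valued-field algebra).
-/
import Literature.NumberTheory.Automorphic.UnitaryQuaternionDictionaryRankTwo   -- ★ `q(a,b) ∈ U(⟨1,−ξ⟩)`, `SU = {q(a,b)}` (the cyclic-algebra model)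
import Mathlib.Topology.Algebra.Valued.ValuationTopology
import HarnessLib

/-!
# The anisotropic unitary plane `U(σ, ⟨1, −ξ⟩)(K)` over a discretely valued field with `|ξ| = exp(−1)`: EVERY element is an integral matrix,
# `|g₀₀|, |g₁₀|, |g₁₁| ≤ 1`, `|g₀₁| ≤ |ξ|`, and the diagonal norms are `≡ 1`: `|σ(g₀₀)g₀₀ − 1| < 1`, `|σ(g₁₁)g₁₁ − 1| < 1`
# (Rogawski 1990 §3.8 p. 33 «`H′_ξ` … anisotropic iff `ξ ∉ NE*`»; Platonov–Rapinchuk 1994 §3.3; Weil 1982 Ch. II §2.2)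

Topic `NumberTheory/Automorphic`; namespace `Literature.NumberTheory.Automorphic.UnitaryGroup` (home of ★ `UnitaryQuaternionDictionaryRankTwo`).  THEOREMS ONLY (no definition,
no instance, no notation, no named fact, no `sorry`); kernel lane `--kind proof --supports stmt-HodgeConjecture-24833` (count-neutral).  Cell `pub/hodgecm-mathlib`, crux H413 =
`stmt-HodgeConjecture-24833`, Track B E3∕E4 junction ‹S› `sig_K2E3SingularTransferSigned`, ROAD J, letter **J3** `sig_K2E3CompatibleMeasureEPIdentityRankOne` (v2, ∃-form; K2E4-plan
(g2) 2026-09-04T00:39:25Z) = «`r · a_θ · t^ω_v(ε′)(Z(ε′)) = 1`» [Kottwitz1988 §1] = [Rogawski1990 §8.1 p. 117 «`d(j)` is independent of `j`»]; payer road R3 (K2E3-p15 (g2), road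
owner 00:40Z): the COMPACT SHEET's number `t^ω_v(ε′)(Z(ε′)) = vol(U(2)_an)·vol(U(1)) = (q+1)³∕q⁴` at an inert unramified `v ∤ 2`, of which the new count is the mass
`(q+1)²∕q³` of the ANISOTROPIC UNITARY PLANE.  This file is its generic algebraic core (brick **R3b-1**); the residual count `[U : K(2ϖ)] = (q+1)²q²` at a CM place and the
assembly with ★ R3a-1 `UnitaryFinTopFormMassAtRadius` §3 are the sequels (R3b-2, R3b-3).

THE MATHEMATICS.  `K` a field with a valuation `|·|` into `ℤᵐ⁰`, `σ` an isometric ring endomorphism (`|σx| = |x|`), `ξ ∈ K` with `|ξ| = exp(−1)` (a uniformiser: the hermitian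
plane `⟨1, −ξ⟩ = diag(1, −ξ)` is then ANISOTROPIC — `|a σa| = |a|²` has even exponent, `|ξ b σb|` odd).  For `g = (a b; c d) ∈ GL₂(K)` with `ᵗ(σg)·diag(1,−ξ)·g = diag(1,−ξ)`
the entries of that identity read
  `σa·a − ξ·σc·c = 1`, `σa·b − ξ·σc·d = 0`, `σb·b − ξ·σd·d = −ξ`.
PARITY (§1): `|x|² ≠ exp(−1)·|y|²` unless `x = y = 0`, so by the ultrametric equality `|σx·x − ξ·σy·y| = max(|x|², exp(−1)|y|²)`; hence (§2) from the first identity `|a| ≤ 1`,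
`|c| ≤ 1` (`exp(−1)|c|² ≤ 1` forces `|c| ≤ 1` in `ℤᵐ⁰`) and `σa·a = 1 + ξσc·c ≡ 1`; from the third `|b|² ≤ exp(−1)` so `|b| ≤ exp(−1)`, `|d| ≤ 1`, and `σd·d = 1 + ξ⁻¹σb·b ≡ 1`
(`|ξ⁻¹ σb b| ≤ exp(−1)`).  So **`U(⟨1,−ξ⟩)(K) ⊆ GL₂(𝒪_K)` with `g ≡ (a 0; c d) mod 𝔪`, `N(a) ≡ N(d) ≡ 1`** — the compact group `U(2)_an` IS its own integral model, and its
reduction lands in the `(q+1)·q²·(q+1)`-element set `{(α 0; γ δ) : Nα = Nδ = 1}` (sequel).  Conversely (§3) `diag(z, 1) ∈ U` for `σz·z = 1` and `q(a,b) = (a ξb; σb σa) ∈ U` for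
`aσa − ξbσb = 1` (★ `quatMat_mem_unitaryGroupOfForm`), with `diag(z,1)·q(a,b) = (za zξb; σb σa)` — the lifts used by the count.

* §1 `valued_sq_ne_exp_neg_one_mul_sq`, `valued_normSub_eq_max` (`|σx·x − ξσy·y| = max …`), `valued_le_one_of_sq_le_one`, `valued_le_one_of_exp_neg_one_mul_sq_le_one`,
  `valued_le_exp_neg_one_of_sq_le`.
* §2 `anisoPlane_entry_relations` (the three identities), **`anisoPlane_valued_le`** (`|a|,|c|,|d| ≤ 1`, `|b| ≤ exp(−1)`), **`anisoPlane_valued_norm_sub_one_lt`** (`|σa a − 1| < 1`,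
  `|σd d − 1| < 1`).
* §3 `diag_mem_unitaryGroupOfForm_anisoPlane`, `diag_mul_quatMat` (entries of the lift `diag(z,1)·q(a,b)`).

HONEST LABEL: count-neutral algebra; HC_CM is proved only modulo the 7 printed citations (2 remaining named inputs: hLiu418 = `stmt-HodgeConjecture-24832`, h413 = `stmt-HodgeConjecture-24833`)
until rung 0 closes; J3 is NOT proved here.

## References
* [Rogawski1990] J. D. Rogawski, *Automorphic Representations of Unitary Groups in Three Variables*, Ann. of Math. Stud. 123 (1990), §3.8 p. 33 (the planes `H′_ξ`; anisotropic iff `ξ ∉ NE*`).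
* [PlatonovRapinchuk1994] V. Platonov, A. Rapinchuk, *Algebraic Groups and Number Theory* (1994), §3.3 (compact groups of anisotropic forms are their own integral points), §3.5.
* [Weil1982] A. Weil, *Adeles and Algebraic Groups*, Progress in Math. 23 (1982), Ch. II §2.2.
* [Kottwitz1988] R. E. Kottwitz, Tamagawa numbers, Ann. of Math. 127 (1988), §1 Thm. 1 (the identity this road serves).
-/

set_option autoImplicit false

noncomputable section

open scoped Matrix MatrixGroups
open Matrix WithZero

namespace Literature.NumberTheory.Automorphic

namespace UnitaryGroup

section Parity

variable {K : Type*} [Field K] [Valued K ℤᵐ⁰]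

/-! ## §1 Valuation parity in `ℤᵐ⁰` -/

/-- **PARITY**: `|x|² ≠ exp(−1)·|y|²` in `ℤᵐ⁰` unless `x = y = 0` (an even exponent is never an odd one). [cite: PlatonovRapinchuk1994, §3.3] -/
theorem valued_sq_ne_exp_neg_one_mul_sq {x y : K} (hxy : x ≠ 0 ∨ y ≠ 0) :
    Valued.v x ^ 2 ≠ exp (-1 : ℤ) * Valued.v y ^ 2 := by
  intro h
  by_cases hx : x = 0
  · have hy : y ≠ 0 := hxy.resolve_left (not_not.2 hx)
    rw [hx, map_zero, zero_pow two_ne_zero] at h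
    exact (mul_ne_zero exp_ne_zero (pow_ne_zero 2 ((Valuation.ne_zero_iff _).2 hy))) h.symm
  · by_cases hy : y = 0
    · rw [hy, map_zero, zero_pow two_ne_zero, mul_zero] at h
      exact (pow_ne_zero 2 ((Valuation.ne_zero_iff _).2 hx)) h
    · have hx' : Valued.v x ≠ 0 := (Valuation.ne_zero_iff _).2 hx
      have hy' : Valued.v y ≠ 0 := (Valuation.ne_zero_iff _).2 hy
      have ex : Valued.v x = exp (log (Valued.v x)) := (exp_log hx').symm
      have ey : Valued.v y = exp (log (Valued.v y)) := (exp_log hy').symm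
      rw [ex, ey, ← WithZero.exp_nsmul, ← WithZero.exp_nsmul, ← exp_add, exp_inj] at h
      simp only [nsmul_eq_mul, Nat.cast_ofNat] at h
      omega

/-- **`|σx·x − ξ·σy·y| = max(|x|², exp(−1)·|y|²)`** for an isometric `σ` and `|ξ| = exp(−1)` (ultrametric equality at distinct values; both sides `0` at `x = y = 0`).
[cite: PlatonovRapinchuk1994, §3.3] -/
theorem valued_normSub_eq_max (σ : K →+* K) (hvσ : ∀ x, Valued.v (σ x) = Valued.v x) {ξ : K} (hξ : Valued.v ξ = exp (-1 : ℤ)) (x y : K) :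
    Valued.v (σ x * x - ξ * (σ y * y)) = max (Valued.v x ^ 2) (exp (-1 : ℤ) * Valued.v y ^ 2) := by
  have h1 : Valued.v (σ x * x) = Valued.v x ^ 2 := by rw [map_mul, hvσ, sq]
  have h2 : Valued.v (-(ξ * (σ y * y))) = exp (-1 : ℤ) * Valued.v y ^ 2 := by rw [Valuation.map_neg, map_mul, map_mul, hξ, hvσ, sq]
  by_cases h0 : x = 0 ∧ y = 0
  · obtain ⟨rfl, rfl⟩ := h0
    simp
  · have hxy : x ≠ 0 ∨ y ≠ 0 := by
      by_contra h; push Not at h; exact h0 h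
    have hne : Valued.v (σ x * x) ≠ Valued.v (-(ξ * (σ y * y))) := by
      rw [h1, h2]; exact valued_sq_ne_exp_neg_one_mul_sq hxy
    rw [sub_eq_add_neg, Valuation.map_add_of_distinct_val _ hne, h1, h2]

/-- In a linearly ordered commutative group with zero: `γ² ≤ 1 ⇒ γ ≤ 1`. [cite: PlatonovRapinchuk1994, §3.3] -/
theorem valued_le_one_of_sq_le_one {x : K} (h : Valued.v x ^ 2 ≤ 1) : Valued.v x ≤ 1 := by
  by_contra hlt
  push Not at hlt
  have : (1 : ℤᵐ⁰) < Valued.v x ^ 2 := by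
    rw [sq]; exact one_lt_mul'' hlt hlt
  exact absurd h (not_le.2 this)

/-- In `ℤᵐ⁰`: `exp(−1)·γ² ≤ 1 ⇒ γ ≤ 1` (`2n − 1 ≤ 0 ⇒ n ≤ 0`). [cite: PlatonovRapinchuk1994, §3.3] -/
theorem valued_le_one_of_exp_neg_one_mul_sq_le_one {x : K} (h : exp (-1 : ℤ) * Valued.v x ^ 2 ≤ 1) : Valued.v x ≤ 1 := by
  by_cases hx : x = 0
  · rw [hx, map_zero]; exact zero_le
  · have hx' : Valued.v x ≠ 0 := (Valuation.ne_zero_iff _).2 hx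
    rw [← exp_log hx', ← WithZero.exp_nsmul, ← exp_add, ← exp_zero, exp_le_exp] at h
    rw [← exp_log hx', ← exp_zero, exp_le_exp]
    simp only [nsmul_eq_mul, Nat.cast_ofNat] at h
    omega

/-- In `ℤᵐ⁰`: `γ² ≤ exp(−1) ⇒ γ ≤ exp(−1)` (`2n ≤ −1 ⇒ n ≤ −1`). [cite: PlatonovRapinchuk1994, §3.3] -/
theorem valued_le_exp_neg_one_of_sq_le {x : K} (h : Valued.v x ^ 2 ≤ exp (-1 : ℤ)) : Valued.v x ≤ exp (-1 : ℤ) := by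
  by_cases hx : x = 0
  · rw [hx, map_zero]; exact zero_le
  · have hx' : Valued.v x ≠ 0 := (Valuation.ne_zero_iff _).2 hx
    rw [← exp_log hx', ← WithZero.exp_nsmul, exp_le_exp] at h
    rw [← exp_log hx', exp_le_exp]
    simp only [nsmul_eq_mul, Nat.cast_ofNat] at h
    omega

/-- In `ℤᵐ⁰`: `exp(−1)·γ² ≤ exp(−1) ⇒ γ ≤ 1`. [cite: PlatonovRapinchuk1994, §3.3] -/
theorem valued_le_one_of_exp_neg_one_mul_sq_le {x : K} (h : exp (-1 : ℤ) * Valued.v x ^ 2 ≤ exp (-1 : ℤ)) : Valued.v x ≤ 1 := by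
  by_cases hx : x = 0
  · rw [hx, map_zero]; exact zero_le
  · have hx' : Valued.v x ≠ 0 := (Valuation.ne_zero_iff _).2 hx
    rw [← exp_log hx', ← WithZero.exp_nsmul, ← exp_add, exp_le_exp] at h
    rw [← exp_log hx', ← exp_zero, exp_le_exp]
    simp only [nsmul_eq_mul, Nat.cast_ofNat] at h
    omega

end Parity

/-! ## §2 The entries of an element of the anisotropic plane `U(σ, diag(1, −ξ))` -/

section Entries

variable {K : Type*} [Field K] (σ : K →+* K) (ξ : K)

/-- **The three entry relations** of `ᵗ(σg)·diag(1,−ξ)·g = diag(1,−ξ)` for `g = (a b; c d)`: `σa·a − ξσc·c = 1`, `σa·b − ξσc·d = 0`, `σb·b − ξσd·d = −ξ`.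
[cite: Rogawski1990, §3.8 p. 33] -/
theorem anisoPlane_entry_relations {g : GL (Fin 2) K} (hg : g ∈ unitaryGroupOfForm σ !![(1 : K), 0; 0, -ξ]) :
    σ (g 0 0) * g 0 0 - ξ * (σ (g 1 0) * g 1 0) = 1 ∧ σ (g 0 0) * g 0 1 - ξ * (σ (g 1 0) * g 1 1) = 0 ∧
      σ (g 0 1) * g 0 1 - ξ * (σ (g 1 1) * g 1 1) = -ξ := by
  rw [mem_unitaryGroupOfForm_iff] at hg
  have h00 := congrFun (congrFun hg 0) 0
  have h01 := congrFun (congrFun hg 0) 1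
  have h11 := congrFun (congrFun hg 1) 1
  simp only [Matrix.mul_apply, Matrix.transpose_apply, Matrix.map_apply, Fin.sum_univ_two, Matrix.of_apply, Matrix.cons_val', Matrix.cons_val_zero,
    Matrix.cons_val_one, Matrix.empty_val', Matrix.cons_val_fin_one, Fin.isValue] at h00 h01 h11
  refine ⟨?_, ?_, ?_⟩
  · linear_combination h00
  · linear_combination h01
  · linear_combination h11

variable [Valued K ℤᵐ⁰] (hvσ : ∀ x, Valued.v (σ x) = Valued.v x) {ξ} (hξ : Valued.v ξ = exp (-1 : ℤ))

include hvσ hξ in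
/-- **EVERY ELEMENT OF THE ANISOTROPIC PLANE IS INTEGRAL**: `|a| ≤ 1`, `|b| ≤ exp(−1)`, `|c| ≤ 1`, `|d| ≤ 1` for `g = (a b; c d) ∈ U(σ, diag(1,−ξ))(K)`, `|ξ| = exp(−1)` —
the compact group of an anisotropic form is its own integral model. [cite: PlatonovRapinchuk1994, §3.3] [cite: Rogawski1990, §3.8 p. 33] -/
theorem anisoPlane_valued_le {g : GL (Fin 2) K} (hg : g ∈ unitaryGroupOfForm σ !![(1 : K), 0; 0, -ξ]) :
    Valued.v (g 0 0 : K) ≤ 1 ∧ Valued.v (g 0 1 : K) ≤ exp (-1 : ℤ) ∧ Valued.v (g 1 0 : K) ≤ 1 ∧ Valued.v (g 1 1 : K) ≤ 1 := by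
  obtain ⟨h00, -, h11⟩ := anisoPlane_entry_relations σ ξ hg
  have m00 := valued_normSub_eq_max σ hvσ hξ (g 0 0) (g 1 0)
  rw [h00, map_one] at m00
  have m11 := valued_normSub_eq_max σ hvσ hξ (g 0 1) (g 1 1)
  rw [h11, Valuation.map_neg, hξ] at m11
  have ha : Valued.v (g 0 0 : K) ^ 2 ≤ 1 := le_of_le_of_eq (le_max_left _ _) m00.symm
  have hc : exp (-1 : ℤ) * Valued.v (g 1 0 : K) ^ 2 ≤ 1 := le_of_le_of_eq (le_max_right _ _) m00.symm
  have hb : Valued.v (g 0 1 : K) ^ 2 ≤ exp (-1 : ℤ) := le_of_le_of_eq (le_max_left _ _) m11.symm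
  have hd : exp (-1 : ℤ) * Valued.v (g 1 1 : K) ^ 2 ≤ exp (-1 : ℤ) := le_of_le_of_eq (le_max_right _ _) m11.symm
  exact ⟨valued_le_one_of_sq_le_one ha, valued_le_exp_neg_one_of_sq_le hb, valued_le_one_of_exp_neg_one_mul_sq_le_one hc,
    valued_le_one_of_exp_neg_one_mul_sq_le hd⟩

include hvσ hξ in
/-- **The diagonal norms are `≡ 1`**: `|σa·a − 1| < 1` and `|σd·d − 1| < 1` (`σa·a − 1 = ξσc·c`, `σd·d − 1 = ξ⁻¹σb·b` with `|b| ≤ |ξ|`).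
[cite: PlatonovRapinchuk1994, §3.3] [cite: Rogawski1990, §3.8 p. 33] -/
theorem anisoPlane_valued_norm_sub_one_lt {g : GL (Fin 2) K} (hg : g ∈ unitaryGroupOfForm σ !![(1 : K), 0; 0, -ξ]) :
    Valued.v (σ (g 0 0) * g 0 0 - 1) < 1 ∧ Valued.v (σ (g 1 1) * g 1 1 - 1) < 1 := by
  obtain ⟨h00, -, h11⟩ := anisoPlane_entry_relations σ ξ hg
  obtain ⟨-, hb, hc, -⟩ := anisoPlane_valued_le σ hvσ hξ hg
  have hξ0 : ξ ≠ 0 := fun h => by rw [h, map_zero] at hξ; exact exp_ne_zero hξ.symm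
  have e1 : exp (-1 : ℤ) < (1 : ℤᵐ⁰) := by rw [← exp_zero, exp_lt_exp]; norm_num
  refine ⟨?_, ?_⟩
  · have e : σ (g 0 0) * g 0 0 - 1 = ξ * (σ (g 1 0) * g 1 0) := by linear_combination h00
    rw [e, map_mul, map_mul, hξ, hvσ]
    calc exp (-1 : ℤ) * (Valued.v (g 1 0 : K) * Valued.v (g 1 0 : K)) ≤ exp (-1 : ℤ) * (1 * 1) :=
          mul_le_mul_right (mul_le_mul' hc hc) _
      _ < 1 := by rwa [mul_one, mul_one]
  · have e : σ (g 1 1) * g 1 1 - 1 = ξ⁻¹ * (σ (g 0 1) * g 0 1) := by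
      rw [eq_inv_mul_iff_mul_eq₀ hξ0]
      linear_combination -h11
    rw [e, map_mul, map_mul, map_inv₀, hξ, hvσ]
    calc (exp (-1 : ℤ))⁻¹ * (Valued.v (g 0 1 : K) * Valued.v (g 0 1 : K)) ≤ (exp (-1 : ℤ))⁻¹ * (exp (-1 : ℤ) * exp (-1 : ℤ)) :=
          mul_le_mul_right (mul_le_mul' hb hb) _
      _ = exp (-1 : ℤ) := by rw [← mul_assoc, inv_mul_cancel₀ exp_ne_zero, one_mul]
      _ < 1 := e1

end Entries

/-! ## §3 The lifts `diag(z, 1)` and `diag(z, 1)·q(a, b)` -/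

section Lifts

variable {S : Type*} [CommRing S] (σ : S →+* S) (ξ : S)

/-- **`diag(z, 1) ∈ U(σ, diag(1, −ξ))` for `σz·z = 1`** (the `U(1)`-factor carrying the determinant: `det = z`). [cite: Rogawski1990, §3.8 p. 33] -/
theorem diag_mem_unitaryGroupOfForm_anisoPlane {g : GL (Fin 2) S} {z : S} (hg : (g : Matrix (Fin 2) (Fin 2) S) = !![z, 0; 0, 1]) (hz : σ z * z = 1) :
    g ∈ unitaryGroupOfForm σ !![(1 : S), 0; 0, -ξ] := by
  rw [mem_unitaryGroupOfForm_iff, hg]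
  ext i j
  fin_cases i <;> fin_cases j <;>
    simp [Matrix.mul_apply, Fin.sum_univ_two, Matrix.transpose_apply, Matrix.map_apply, hz]

/-- **The product lift**: `diag(z, 1) · q(a, b) = (z·a  z·ξ·b ; σb  σa)`. [cite: Rogawski1990, §3.8 p. 33] -/
theorem diag_mul_quatMat (z a b : S) :
    (!![z, 0; 0, 1] : Matrix (Fin 2) (Fin 2) S) * !![a, ξ * b; σ b, σ a] = !![z * a, z * (ξ * b); σ b, σ a] := by
  ext i j
  fin_cases i <;> fin_cases j <;> simp [Matrix.mul_apply, Fin.sum_univ_two]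

/-- The product lift is unitary with determinant `z` when `σz·z = 1` and `aσa − ξbσb = 1` (★ `quatMat_mem_unitaryGroupOfForm` × §3). [cite: Rogawski1990, §3.8 p. 33] -/
theorem diag_mul_quatMat_mem_unitaryGroupOfForm (hσ : ∀ x, σ (σ x) = x) (hξ : σ ξ = ξ) {g : GL (Fin 2) S} {z a b : S}
    (hg : (g : Matrix (Fin 2) (Fin 2) S) = !![z * a, z * (ξ * b); σ b, σ a]) (hz : σ z * z = 1) (h1 : a * σ a - ξ * (b * σ b) = 1) :
    g ∈ unitaryGroupOfForm σ !![(1 : S), 0; 0, -ξ] := by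
  -- `g = D · Q` with `D = diag(z,1)`, `Q = q(a,b)` both unitary; build them as units
  have hzu : IsUnit z := isUnit_iff_exists_inv.2 ⟨σ z, by rw [mul_comm]; exact hz⟩
  have hQdet : IsUnit (!![a, ξ * b; σ b, σ a] : Matrix (Fin 2) (Fin 2) S).det := by
    rw [det_quatMat, h1]; exact isUnit_one
  have hDdet : IsUnit (!![z, 0; 0, 1] : Matrix (Fin 2) (Fin 2) S).det := by
    rw [Matrix.det_fin_two_of]; simpa using hzu
  set D : GL (Fin 2) S := Matrix.GeneralLinearGroup.mk'' _ hDdet with hD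
  set Q : GL (Fin 2) S := Matrix.GeneralLinearGroup.mk'' _ hQdet with hQ
  have hDmem : D ∈ unitaryGroupOfForm σ !![(1 : S), 0; 0, -ξ] := diag_mem_unitaryGroupOfForm_anisoPlane σ ξ (g := D) rfl hz
  have hQmem : Q ∈ unitaryGroupOfForm σ !![(1 : S), 0; 0, -ξ] := quatMat_mem_unitaryGroupOfForm σ ξ hσ hξ (g := Q) rfl h1
  have hgDQ : g = D * Q := by
    refine Units.ext ?_
    rw [Units.val_mul, hg]
    change _ = (!![z, 0; 0, 1] : Matrix (Fin 2) (Fin 2) S) * !![a, ξ * b; σ b, σ a]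
    rw [diag_mul_quatMat]
  rw [hgDQ]
  exact Subgroup.mul_mem _ hDmem hQmem

end Lifts

end UnitaryGroup

end Literature.NumberTheory.Automorphic

end
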